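import Summits.SmoothPoincare4.SmoothPoincare4.Theorems.SymplecticOrigamiOrigamiFoldExistenceStubOuterCleanRecognitionChartSheets

/-!
# Stub `stub_outerCleanRecognitionChart` of line `shadow-pleats` for crux `OrigamiFoldExistence` — H:
# the sheet count ACROSS THE SEAM SPHERE (item stmt-SmoothPoincare4-7844, route SymplecticOrigami; seat c3, S4''-chart worker)

Eighth helper file towards `stub_outerCleanRecognitionChart : OuterCleanRecognitionChart`, over
file G (`…ChartSheets`: the counting sets `sheet0/1/2` of the outer part `P⁺` over the shadow
plane, locally constant off `S_ρ ∪ c_out`).  Here: the LOCAL RULE at a point `y` of the seam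
sphere `S_ρ` off the outer crease — the jump `n_P(inside) = n_P(outside) + 1` of the lead's
count (O2)(a) in the form the propagation consumes.  Over the seam point `mₛ` above `y` one
sheet of `P⁺` (the seam sheet, `exists_seamSheet`) covers exactly the inside `{‖z‖ < ρ}` near
`y`; every other point of `P̄⁺` over `y` is a THROUGH-SHEET (a point of `P⁺`, where the shadow is
a local homeomorphism).  Hence, on a small ball `B` around `y` missing the crease
(`seam_rule`, registered helper):

* EITHER (no through-sheet) `B ∩ {‖z‖ < ρ} ⊆ sheet1` and `B ∩ {ρ < ‖z‖} ⊆ sheet0`,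
* OR (a through-sheet) `B ∩ {‖z‖ < ρ} ⊆ sheet2` and `B ∩ {ρ < ‖z‖}` misses `sheet0`;

and in any case (`exists_ball_inside_witness`, valid at EVERY point of `S_ρ`, also on the
crease) the inside points near `y` carry a sheet of `P⁺` far from the chart ball.

Sources: the S5a file `…StubCleanOnePleatIroningSeamSheet` (`exists_seamSheet`); the lead's
`OuterClean-analysis-c3.md` §3 (O2)(a).
-/

noncomputable section

-- the prescribed namespace `Summit.<P>.<Sub>.…` duplicates `SmoothPoincare4` (P = Sub)
set_option linter.dupNamespace false

open scoped Manifold ContDiff Topology RealInnerProductSpace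
open Set Function Filter Metric

namespace Summit.SmoothPoincare4.SmoothPoincare4.Theorems.OrigamiFoldExistence.ShadowPleats

section Seam

variable {M : Type} [TopologicalSpace M] [ChartedSpace (EuclideanSpace ℝ (Fin 4)) M]
  {ι : M → EuclideanSpace ℝ (Fin 5)} {δ : ℝ} {e : Fin 1 → EuclideanSpace ℝ (Fin 4) → M}

/-- **Over every point of the seam sphere there is a seam point** `mₛ` (`h(mₛ) = 1 - δ`,
shadow `y`), by the round clause. -/
theorem exists_seamPoint (h : IsPleatedPosition ι δ e) {y : EuclideanSpace ℝ (Fin 4)}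
    (hy : ‖y‖ = Real.sqrt (1 - (1 - δ) ^ 2)) : ∃ ms : M, ι ms 4 = 1 - δ ∧ proj5 (ι ms) = y := by
  obtain ⟨-, hδ, hδ1, hround, -⟩ := h
  set p : EuclideanSpace ℝ (Fin 5) := embedL y + (1 - δ) • e4 with hp
  have hρsq : Real.sqrt (1 - (1 - δ) ^ 2) ^ 2 = 1 - (1 - δ) ^ 2 := Real.sq_sqrt (by nlinarith)
  have hpS : p ∈ Metric.sphere (0 : EuclideanSpace ℝ (Fin 5)) 1 := by
    have h1 : ‖p‖ ^ 2 = 1 := by rw [hp, norm_sq_embedL_add_smul, hy, hρsq]; ring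
    have h2 : ‖p‖ = 1 := by nlinarith [norm_nonneg p]
    simpa using h2
  have hp4 : p 4 = 1 - δ := by simp [hp, embedL_apply]
  obtain ⟨ms, hms⟩ := mem_range_of_mem_sphere hround hpS hp4.le
  refine ⟨ms, by rw [hms, hp4], ?_⟩
  rw [hms, hp, proj5_add, proj5_smul, proj5_embedL, proj5_e4, smul_zero, add_zero]

/-- Two seam points with the same shadow coincide. -/
theorem eq_of_seam (h : IsPleatedPosition ι δ e) {a b : M} (ha : ι a 4 = 1 - δ) (hb : ι b 4 = 1 - δ)
    (hab : proj5 (ι a) = proj5 (ι b)) : a = b := by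
  apply h.1.isEmbedding.injective
  rw [← embedL_proj5_add_smul (ι a), ← embedL_proj5_add_smul (ι b), hab, ha, hb]

/-- A seam point is not in the closed chart image `e₀(B̄_r)`. -/
theorem seam_notMem_chart (h : IsPleatedPosition ι δ e) {ms : M} (hms : ι ms 4 = 1 - δ) (r : ℝ) :
    ms ∉ e 0 '' Metric.closedBall 0 r := by
  rintro ⟨u, -, rfl⟩
  exact absurd hms (ne_of_gt ((h.2.2.2.2.1 0).2 u))

/-- The outer crease is closed. -/
theorem isClosed_crease (h : IsPleatedPosition ι δ e) : IsClosed ((proj5 ∘ ι ∘ e 0) '' Metric.sphere (0 : EuclideanSpace ℝ (Fin 4)) 2) :=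
  ((isCompact_sphere (0 : EuclideanSpace ℝ (Fin 4)) 2).image (contDiff_chartShadow h).continuous).isClosed

variable [T2Space M] [CompactSpace M] [IsManifold (𝓡 4) ∞ M]

omit [CompactSpace M] in
/-- **Inside points near the seam sphere carry a sheet of `P⁺` far from the chart** (valid at
every point of `S_ρ`, also on the crease): near `y ∈ S_ρ`, every `z` with `‖z‖ < ρ` is the shadow
of a point of the outer part outside `e₀(B̄₃)`. -/
theorem exists_ball_inside_witness (h : IsPleatedPosition ι δ e) {y : EuclideanSpace ℝ (Fin 4)}
    (hy : ‖y‖ = Real.sqrt (1 - (1 - δ) ^ 2)) :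
    ∃ ε : ℝ, 0 < ε ∧ ∀ z ∈ Metric.ball y ε, ‖z‖ < Real.sqrt (1 - (1 - δ) ^ 2) →
      ∃ m ∈ outerPart ι δ (e 0), m ∉ e 0 '' Metric.closedBall 0 3 ∧ proj5 (ι m) = z := by
  obtain ⟨ms, hms, hmsy⟩ := exists_seamPoint h hy
  have hW : IsOpen (e 0 '' Metric.closedBall (0 : EuclideanSpace ℝ (Fin 4)) 3)ᶜ :=
    ((isCompact_closedBall (0 : EuclideanSpace ℝ (Fin 4)) 3).image (h.2.2.2.2.1 0).1.contMDiff.continuous).isClosed.isOpen_compl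
  obtain ⟨U, hU, hmsU, hUW, -, himg, hchar⟩ :=
    exists_seamSheet h.1 h.2.1 h.2.2.1 h.2.2.2.1 hms hW (seam_notMem_chart h hms 3)
  obtain ⟨ε, hε, hball⟩ := Metric.isOpen_iff.1 (himg U Subset.rfl hU) y ⟨ms, hmsU, hmsy⟩
  refine ⟨ε, hε, fun z hz hzρ => ?_⟩
  obtain ⟨m, hmU, hmz⟩ := hball hz
  have hup : 1 - δ < ι m 4 := (hchar m hmU).2 (by rw [show proj5 (ι m) = z from hmz]; exact hzρ)
  have hm3 : m ∉ e 0 '' Metric.closedBall 0 3 := hUW hmU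
  exact ⟨m, ⟨hup, fun hm2 => hm3 (Set.image_mono (Metric.closedBall_subset_closedBall (by norm_num)) hm2)⟩, hm3, hmz⟩

/-- **THE SEAM RULE** (registered helper of file H).  At a point `y` of the seam sphere off the
outer crease there is a ball `B` around `y` missing the crease such that EITHER the inside of
`B` has exactly one sheet and the outside none, OR the inside has at least two sheets and the
outside at least one. [folklore] -/
theorem seam_rule (h : IsPleatedPosition ι δ e) {y : EuclideanSpace ℝ (Fin 4)} (hy : ‖y‖ = Real.sqrt (1 - (1 - δ) ^ 2)) (hyC : y ∉ (proj5 ∘ ι ∘ e 0) '' Metric.sphere 0 2) : ∃ ε : ℝ, 0 < ε ∧ Disjoint (Metric.ball y ε) ((proj5 ∘ ι ∘ e 0) '' Metric.sphere 0 2) ∧ (((∀ z ∈ Metric.ball y ε, ‖z‖ < Real.sqrt (1 - (1 - δ) ^ 2) → z ∈ sheet1 ι δ (e 0)) ∧ (∀ z ∈ Metric.ball y ε, Real.sqrt (1 - (1 - δ) ^ 2) < ‖z‖ → z ∈ sheet0 ι δ (e 0))) ∨ ((∀ z ∈ Metric.ball y ε, ‖z‖ < Real.sqrt (1 - (1 -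 δ) ^ 2) → z ∈ sheet2 ι δ (e 0)) ∧ (∀ z ∈ Metric.ball y ε, Real.sqrt (1 - (1 - δ) ^ 2) < ‖z‖ → z ∉ sheet0 ι δ (e 0)))) := by
  set ρ := Real.sqrt (1 - (1 - δ) ^ 2) with hρ
  set C := (proj5 ∘ ι ∘ e 0) '' Metric.sphere (0 : EuclideanSpace ℝ (Fin 4)) 2 with hC
  obtain ⟨ms, hms, hmsy⟩ := exists_seamPoint h hy
  -- the seam sheet, off the closed chart ball
  have hW₀ : IsOpen (e 0 '' Metric.closedBall (0 : EuclideanSpace ℝ (Fin 4)) 2)ᶜ :=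
    ((isCompact_closedBall (0 : EuclideanSpace ℝ (Fin 4)) 2).image (h.2.2.2.2.1 0).1.contMDiff.continuous).isClosed.isOpen_compl
  obtain ⟨U₀, hU₀, hmsU₀, hU₀W, hinj₀, himg₀, hchar₀⟩ :=
    exists_seamSheet h.1 h.2.1 h.2.2.1 h.2.2.2.1 hms hW₀ (seam_notMem_chart h hms 2)
  -- a ball around `y` missing the crease
  obtain ⟨εC, hεC, hballC⟩ := Metric.isOpen_iff.1 (isClosed_crease h).isOpen_compl y hyC
  -- points of `U₀` above the plane are in the outer part
  have hP_of_U₀ : ∀ m ∈ U₀, 1 - δ < ι m 4 → m ∈ outerPart ι δ (e 0) := fun m hm hup => ⟨hup, hU₀W hm⟩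
  set F := (proj5 ∘ ι) '' (outerPartK ι δ (e 0) \ U₀) with hF
  have hFclosed : IsClosed F := isClosed_shadow_outerPartK_diff h hU₀
  by_cases hyF : y ∈ F
  · -- CASE (b): a through-sheet `c ∈ P⁺ ∖ U₀` over `y`
    obtain ⟨c, ⟨hcK, hcU₀⟩, hcy⟩ := hyF
    have hcP : c ∈ outerPart ι δ (e 0) := by
      by_contra hcP
      rcases apply_eq_or_mem_of_mem_diff hcK hcP with hseam | ⟨u, hu, rfl⟩
      · exact hcU₀ (eq_of_seam h hseam hms (hcy.trans hmsy.symm) ▸ hmsU₀)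
      · exact hyC ⟨u, hu, hcy⟩
    have hne : c ≠ ms := fun heq => hcU₀ (heq ▸ hmsU₀)
    obtain ⟨Oc, Os, hOc, hOs, hcOc, hmsOs, hdisj⟩ := t2_separation hne
    obtain ⟨Uc, hUc, hcUc, hUcW, -, himgc⟩ := exists_nhds_injOn_outerPart h hcP hOc hcOc
    set U := U₀ ∩ Os with hU
    have hUopen : IsOpen U := hU₀.inter hOs
    obtain ⟨ε₁, hε₁, hball₁⟩ := Metric.isOpen_iff.1 (himgc Uc Subset.rfl hUc) y ⟨c, hcUc, hcy⟩
    obtain ⟨ε₂, hε₂, hball₂⟩ := Metric.isOpen_iff.1 (himg₀ U inter_subset_left hUopen) y ⟨ms, ⟨hmsU₀, hmsOs⟩, hmsy⟩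
    refine ⟨min εC (min ε₁ ε₂), by positivity, ?_, Or.inr ⟨fun z hz hzρ => ?_, fun z hz hzρ hz0 => ?_⟩⟩
    · exact Set.disjoint_left.2 fun z hz hzC => hballC (Metric.ball_subset_ball (min_le_left _ _) hz) hzC
    · obtain ⟨a, haUc, haz⟩ := hball₁ (Metric.ball_subset_ball ((min_le_right _ _).trans (min_le_left _ _)) hz)
      obtain ⟨b, ⟨hbU₀, hbOs⟩, hbz⟩ := hball₂ (Metric.ball_subset_ball ((min_le_right _ _).trans (min_le_right _ _)) hz)
      have hbup : 1 - δ < ι b 4 := (hchar₀ b hbU₀).2 (by rw [show proj5 (ι b) = z from hbz]; exact hzρ)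
      have hab : a ≠ b := fun heq => Set.disjoint_left.1 hdisj (hUcW haUc).1 (heq ▸ hbOs)
      exact ⟨a, (hUcW haUc).2, b, hP_of_U₀ b hbU₀ hbup, hab, haz, hbz⟩
    · obtain ⟨a, haUc, haz⟩ := hball₁ (Metric.ball_subset_ball ((min_le_right _ _).trans (min_le_left _ _)) hz)
      exact hz0 a (hUcW haUc).2 haz
  · -- CASE (a): no through-sheet over `y`
    obtain ⟨ε₁, hε₁, hball₁⟩ := Metric.isOpen_iff.1 hFclosed.isOpen_compl y hyF
    obtain ⟨ε₂, hε₂, hball₂⟩ := Metric.isOpen_iff.1 (himg₀ U₀ Subset.rfl hU₀) y ⟨ms, hmsU₀, hmsy⟩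
    -- every `P̄⁺`-preimage of a point of the ball lies in `U₀`
    have hpre : ∀ z ∈ Metric.ball y ε₁, ∀ m ∈ outerPartK ι δ (e 0), proj5 (ι m) = z → m ∈ U₀ := by
      intro z hz m hm hmz
      by_contra hnot
      exact hball₁ hz ⟨m, ⟨hm, hnot⟩, hmz⟩
    refine ⟨min εC (min ε₁ ε₂), by positivity, ?_, Or.inl ⟨fun z hz hzρ => ?_, fun z hz hzρ => ?_⟩⟩
    · exact Set.disjoint_left.2 fun z hz hzC => hballC (Metric.ball_subset_ball (min_le_left _ _) hz) hzC
    · have hz₁ : z ∈ Metric.ball y ε₁ := Metric.ball_subset_ball ((min_le_right _ _).trans (min_le_left _ _)) hz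
      obtain ⟨m, hmU₀, hmz⟩ := hball₂ (Metric.ball_subset_ball ((min_le_right _ _).trans (min_le_right _ _)) hz)
      have hmup : 1 - δ < ι m 4 := (hchar₀ m hmU₀).2 (by rw [show proj5 (ι m) = z from hmz]; exact hzρ)
      refine ⟨m, hP_of_U₀ m hmU₀ hmup, hmz, fun m' hm' hm'z => ?_⟩
      exact hinj₀ (hpre z hz₁ m' (outerPart_subset_outerPartK hm') hm'z) hmU₀ (hm'z.trans hmz.symm)
    · have hz₁ : z ∈ Metric.ball y ε₁ := Metric.ball_subset_ball ((min_le_right _ _).trans (min_le_left _ _)) hz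
      intro m' hm' hm'z
      have hm'U₀ := hpre z hz₁ m' (outerPart_subset_outerPartK hm') hm'z
      have : ‖proj5 (ι m')‖ < ρ := (hchar₀ m' hm'U₀).1 hm'.1
      rw [hm'z] at this
      exact absurd this (not_lt.2 hzρ.le)

end Seam

end Summit.SmoothPoincare4.SmoothPoincare4.Theorems.OrigamiFoldExistence.ShadowPleats

end
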